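import Mathlib
import HarnessLib
import HarnessLib.Audit
import Summits.PneNP.Statement
import Literature.Computability.Complexity.Circuit
import Literature.Computability.Complexity.ConstantDepth
import Literature.Computability.Complexity.CircuitClasses
import Literature.Computability.Complexity.Nondeterministic
import Literature.Computability.Complexity.CircuitLowerBoundsHastadProofs

/-!
Route: RootDecompDepthThree

DORMANT since 2026-09-04T12:43:00Z (reconciler: no traction for 5 d (last activity statement-checked at 2026-08-30T12:01:37Z); parked, not closed — `ledger route dormant route-PneNP-RootDecompDepthThree --off` to reactivate) — unstaffed, not closed; items shared with open routes are served there. `ledger route dormant <id> --off` reactivates.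

# Route RootDecompDepthThree — Root decomposition at Valiant's depth-3 gate

Root-decomposition cell decomp-pnenp, node N22 (lens-4 gen 7 «RootDecompDepthThree — Valiant's
depth-3 gate», HOME/decomp-pnenp-lens-4/DepthThreeLift.lean
sha256 36023abc, NODE-g7.md f559e136, LIFTING-GAP-TABLE-v2.md c2a41e76; critic decomp-pnenp-crit-1
g3 CLEARED 2026-08-30T06:47:12Z, scores once (vii) as a
new chart of the restricted-model schema; filed THIN at the writer's discretion, LOW PRIORITY). It
suffices to show X = A₃ ∧ R₃, the law-D cut of S on
the DEPTH-3 SIZE DIAL ΣΠΣ(g) = `DepthSizeClass acBasis 3 g` at Valiant's scale g = 2^{c·n/log₂log₂n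
+ c}: A₃ = `DepthThreeHard` (¬S → some NP language is
Valiant-hard, i.e. outside ΣΠΣ(2^{c·n/log log n + c}) for every c; crux r2, ATTACKED; S-free road =
Jukna's Research Problem 11.2 for an NP or P function)
and R₃ = `DepthThreeLift` ((∃ Valiant-hard L ∈ NP) → S; crux r3, DECLARED RESIDUAL, PRE-COSTUME
declared: R₃ ≡ S the day any P-language is Valiant-hard,
kernel `depthThreeLift_iff_pneNP_of_PWitness`). S ↔ A₃ ∧ R₃ hypothesis-free (`node_iff`; generic
`cut_iff g` at every scale). No card realised (cell node).
Lean: `(¬ PneNP → ∃ L ∈ Literature.Computability.Complexity.Nondeterministic.NP, ∀ c : ℕ, L ∉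
Literature.Computability.Complexity.DepthSizeClass Literature.Computability.Complexity.acBasis (fun
_ : ℕ => 3) (fun n : ℕ => 2 ^ (c * n / Nat.log 2 (Nat.log 2 n) + c))) ∧ ((∃ L ∈
Literature.Computability.Complexity.Nondeterministic.NP, ∀ c : ℕ, L ∉
Literature.Computability.Complexity.DepthSizeClass Literature.Computability.Complexity.acBasis (fun
_ : ℕ => 3) (fun n : ℕ => 2 ^ (c * n / Nat.log 2 (Nat.log 2 n) + c))) → PneNP)`

## Assembly
Pure logic: `closes (hA : DepthThreeHard) (hR : DepthThreeLift) : PneNP := Classical.byContradiction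
fun hS => hS (hR (hA hS))` (glue.lean; cone =
{DepthThreeHard, DepthThreeLift}; ValiantLift / GKWLift are ASIDES — banked context, never staffed;
the calibration theorems of the lens file are theorems,
not items). Conjunct split S ↔ A₃ ∧ R₃: attacked = DepthThreeHard, declared residual =
DepthThreeLift (tribunal_fit).

Rationale: WHY THIS LINE. The mechanism is the restricted-model schema of N4/N10 (poly-size classes), N13
(arithmetic τ) and N15 (one-tape time) — cut S along «some NP language
escapes model M at scale g» — at a new (model, scale) chart whose two ENDS are DECIDED IN KERNEL
with opposite polarity: BOTTOM every g infinitely often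
below 2^{c√n} has HardAt g a THEOREM and LiftAt g ≡ S (`hastad_bottom` from the tree's proved
switching-lemma theorem `CircuitLowerBoundsHastadProofs.
hastad_parity_holds` at k = 3 + `PARITY_mem_P`; `liftAt_iff_pneNP_of_subHastad`), TOP g =
2^n·(n+1)+1 has LiftAt a THEOREM and HardAt ≡ S (`mem_sigmaPiSigma_top`
via the tree's ACRealize DNF, `liftAt_of_top`, `hardAt_iff_pneNP_of_top`), and Valiant's scale sits
strictly between (`scales_at_two_pow_sixteen`). Imported
from circuit complexity: Valiant's 1977 depth reduction NC¹_lin ⊆ ΣΠΣ(2^{O(n/log log n)}) (Jukna2012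
Lemma 11.1, binder `ValiantLift`) and the
Golovnev–Kulikov–Williams 2018 depth-3 reduction of general circuits (binder `GKWLift`), together
with the kernel LAW II «lift images are Kannan-idle»
(`imageShadow_holds`, `imageResidual_iff_pneNP`, `gkwImageResidual_iff_pneNP`: completing Valiant's
or GKW's programme for an NP function decides nothing
about S — any cut must sit BELOW the lift, i.e. at depth 3 itself) and LAW III «P-witness trigger»
(`liftAt_iff_pneNP_of_PWitness`, generic in g: a
P-function lower bound turns every class-existential restricted-model split into (THEOREM, COSTUME)
— census T45 confirmed in kernel). What no prior
route / negatives entry does: no cell route is typed over exponential-size depth-3 classes; N5's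
refuted `not_monotoneLowerBoundsTransfer_holds` is the
MONOTONE lift (a different row of LIFTING-GAP-TABLE-v2); `ledger negatives --problem PneNP` has no
depth-3 / ΣΠΣ statement.

RANKED CRUXES. #2 DepthThreeHard (crux) — PIECE A₃ (attacked): if P = NP then some NP language is
VALIANT-HARD — outside the depth-3 unbounded-fan-in class ΣΠΣ(2^{c·n/log₂log₂n + c}) for every c
(lens decl `DepthThreeHard := ¬PneNP → ∃ L ∈ NP, ValiantHard L`, inlined over `DepthSizeClass
acBasis 3`). Kernel P-form `depthThreeHard_iff_P`: A₃ ⟺ (¬S → some P language is Valiant-hard);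
S-free road = Jukna Research Problem 11.2 (record 2^{Ω(√n)}, open since 1977). [difficulty:
open-problem] (why it might fail: It cannot fail without deciding S (S → A₃); the risk is that its
only road is Research Problem 11.2, whose known methods stop at 2^{O(√n)} (finite limits) and whose
natural solutions are conditionally excluded by depth-3 weak-PRF candidates (Goldreich-PRG
security).) [Jukna2012, Valiant1977, doi:10.1007/s00037-022-00220-x,
HOME/decomp-pnenp-lens-4/DepthThreeLift.lean sha256 36023abc]
#3 DepthThreeLift (crux) — PIECE R₃ (DECLARED RESIDUAL, PRE-COSTUME declared): a Valiant-hard NP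
language separates P from NP — contrapositively, P = NP ⟹ every NP (= P) language has depth-3
circuits of size 2^{O(n/log log n)} (lens decl `DepthThreeLift`, inlined). Kernel:
`depthThreeLift_iff_pneNP_of_PWitness` — R₃ ≡ S as soon as ANY polynomial-time language is
Valiant-hard (the expected outcome); relativized-false (EXPSPACE oracle, pencil). [deps:
DepthThreeHard] [difficulty: open-problem] (why it might fail: False exactly in the world «P = NP
and some P-language needs depth-3 size 2^{ω(n/log log n)}»; the second conjunct is widely expected
TRUE (it is Research Problem 11.2 itself), so R₃ is expected to carry the whole summit
(pre-costume).) [Jukna2012, Valiant1977, HOME/decomp-pnenp-lens-4/DepthThreeLift.lean sha256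
36023abc]
#9 ValiantLift (support) — PRINT BINDER (ASIDE, formalisation target, NOT in the cone — law II):
Valiant's depth reduction NC¹_lin ⊆ ΣΠΣ(2^{O(n/log log n)}): for every c there is c' with the
fan-in-2 class of depth ≤ c·log₂n + c and size ≤ c·n + c inside ΣΠΣ(2^{c'·n/log₂log₂n + c'})
(Jukna2012 Lemma 11.1; Erdős–Graham–Szemerédi edge removal + CNF bookkeeping). [difficulty: L]
[Jukna2012, Valiant1977]
#9 GKWLift (support) — PRINT BINDER (ASIDE, NOT in the cone — law II(d)): Golovnev–Kulikov–Williams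
2018 — every size-s circuit over the full binary basis is an OR of 2^{⌈s/3.9⌉} ANDs of 2^{14}s ORs
of 16 literals, typed loosely as SIZE(s) ⊆ ΣΠΣ(2^{s/3+1}·(2^{14}s+1) + n + 1); its image is a LINEAR
general size bound, Kannan-idle (`gkwImageResidual_iff_pneNP`, `gkw_ceiling`). [difficulty: L]
[GolovnevKulikovWilliams2018, Jukna2012]

TWO-LAYER PLAN. Foreseen split of DepthThreeHard (plan-only, lens bc3): A₃ ⇐ «∃ L ∈ NP, ValiantHard
L» outright (Research Problem 11.2, NP version) by `fun h _ => h` — honest: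
the skeleton of an open-problem piece is the open problem; the P-version closes A₃ AND costumes R₃
(law III). No split of DepthThreeLift is foreseen (no
independent road; law II discards the lifted forms). Nothing filed now.

KILL CRITERIA. `refuted:DepthThreeLift` as a ROUTE (not as a statement — R₃ is a consequence of S)
by any Valiant-hard function in P: the kernel trigger
`depthThreeLift_iff_pneNP_of_PWitness` then makes R₃ ≡ S and A₃ a theorem — the node degenerates to
(THEOREM, COSTUME) and the route is retired
`superseded`/costume with the census row updated (watch-list «Problem 11.2 for a P-function»). A
depth-3 lower bound 2^{ω(n/log log n)} for an NP function
that is not known to be in P closes A₃'s road without touching R₃ (informative). Neither piece is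
refutable as a statement short of deciding S.

NOT DECOMPOSED YET. Research Problem 11.2 itself (the only road to A₃); the direct road for R₃ (none
known); the port of the lens kernel (`node_iff`, `cut_iff`, `hastad_bottom`,
`liftAt_iff_pneNP_of_subHastad`, `mem_sigmaPiSigma_top`, `liftAt_of_top`, `hardAt_iff_pneNP_of_top`,
`imageShadow_holds`, `imageResidual_iff_pneNP`,
`gkwImageResidual_iff_pneNP`, `liftAt_iff_pneNP_of_PWitness`, `scales_at_two_pow_sixteen`) to
Theorems/ — layer-2 / prover work, LOW PRIORITY.

CHEAPEST FALSIFIER. Literature lookup (run by lens-4 g7 and the critic, 2026-08-30): the best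
explicit depth-3 lower bound is 2^{Ω(√n)} and «all known techniques fail beyond
2^{√n}» [corpus:book:jukna2012 p.316–317]; no P- or NP-function is known Valiant-hard; natural
properties against depth-3 circuits of size 2^{εn} are
excluded unless Goldreich's PRG is insecure [corpus:paper:doi-10-1007-s00037-022-00220-x p.7 Thm 6,
p.8 Thm 8]. Watch item: any explicit 2^{ω(n/log log n)}
depth-3 bound (for a P function it costumes the route; for an NP-complete function it closes A₃'s
road). Not runnable by kit (kit_allowed = false).

NUMBERS. Cone 2/2; items 5 (2 cruxes + 2 asides + Assembly); lens kernel 27/27 decls AXOK {propext,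
Classical.choice, Quot.sound} (critic probe
L4_DepthThreeLift_g7_probe.lean 51d92295); BC7 lens 6/6 CLEAN, writer re-run 2/2 CLEAN; decided
ends: bottom g i.o. < 2^{c√n} (Håstad k = 3, tree theorem),
top g = 2^n·(n+1)+1 (DNF); Valiant scale 2^{c·n/log₂log₂n + c} strictly between at n = 2^16 (kernel
numeric); record explicit depth-3 bound 2^{Ω(√n)}.

DEFINITION REQUESTS. None: `DepthSizeClass`, `acBasis`, `B2`, `SIZE`, `NP` are tree declarations
with oleans; ΣΠΣ(g), Valiant's scale and NC¹_lin are inlined. Port request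
(prover, when idle, low priority): the lens kernel theorems listed under «Not decomposed yet» into
Summits/PneNP/PneNP/Theorems/RootDecompDepthThree*.lean.

Novelty: Searches (2026-08-30, lens-4 g7 + critic g3): lit search --hybrid «depth-3 circuit lower bound
2^{n/log log n} Valiant NP function» (Jukna2012 ch. 11,
GKW18); lit read book:jukna2012 --pages 316-317 --grep 'Research Problem 11.2|known techniques'
(hits p.316–317); lit read doi:10.1007/s00037-022-00220-x
--pages 7-8 (Oliveira–Santhanam–Tell Thms 6/8); lit galaxy search "depth-3 circuits|depth three
circuits|Valiant's depth reduction" --star all (surveys only,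
no statement of either piece); lean search 'DepthSizeClass acBasis' --decl (tree ConstantDepth /
CircuitLowerBoundsHastadProofs; no Valiant-scale decl);
ledger negatives --problem PneNP (no depth-3 / ΣΠΣ row; N5's monotone-lift refutation is a different
row).
Nearest prior art found: [corpus:book:jukna2012 p.316–317] Research Problem 11.2 and the
finite-limits ceiling; [corpus:paper:doi-10-1007-s00037-022-00220-x
p.7–8] conditional natural-proofs exclusion at depth 3/4; in tree route-PneNP-RootDecompAccTransfer
(N4, poly-size ACC/TC cells), route-PneNP-RootDecompParityCell
(N10), route-PneNP-RootDecompTauLift (N13), route-PneNP-RootDecompOneTape (N15) — same schema, other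
(model, scale) charts; GolovnevKulikovWilliams2018 Table 1
(depth-3 reduction of general circuits) as the second lift.
Delta: the exponential-size depth-3 chart of the restricted-model schema with BOTH ends decided in
kernel in opposite polarity and the two kernel laws
(lift images Kannan-idle; P-witness trigger) that locate where any such cut can carry  [refs: 10.1007/s00037-022-00220-x, book:jukna2012, doi:10.1007/s00037-022-00220-x, paper:doi-10-1007-s00037-022-00220-x, Jukna2012, GolovnevKulikovWilliams2018]

Barriers (technique_class: depth-3-circuits, law-D-carving, depth-reduction): - technique_class: depth-3-circuits, law-D-carving, depth-reduction
- Literature.Barriers.PneNP.NaturalProofs: DepthThreeHard INSIDE conditionally — the decided rung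
(Håstad, k = 3) is a natural proof; at exponential scales natural properties against depth-3 (size
2^{εn}) / depth-4 circuits cannot be extended unless Goldreich's PRG is insecure
(doi:10.1007/s00037-022-00220-x Thms 6/8; weak-PRF candidates in depth-3 AC⁰) ⇒ a 2^{ω(n/log log n)}
bound plausibly needs a non-natural argument: leaf IDEA-NEEDED, no theorem excludes Valiant's scale;
and inside Algorithmica (the ¬S hypothesis of A₃) hard PRGs do not exist, so the barrier theorem's
hypothesis fails for the implication shape. DepthThreeLift: residual, exempt.
- Literature.Barriers.PneNP.Locality: the Håstad-side parity rung instantiates it (bottom cells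
decided BY a local/natural argument); the attacked scale 2^{c·n/log log n} is above every bound the
locality-limited switching-lemma family reaches (finite-limits ceiling 2^{O(√n)}, Jukna2012 p.316) —
INSIDE for the known method family; the bet is a new method (graph-entropy / algorithmic-method
candidates, none typed).
- Literature.Barriers.PneNP.Relativization: DepthThreeHard OUTSIDE — oracle-free constant-depth
circuit statements are not in the barrier's quantifier range; DepthThreeLift RELATIVIZED-FALSE
(EXPSPACE-oracle pencil) ⇒ requires a non-relativizing proof, declared (same standing as every law-D
residual).
- Literature.Barriers.PneNP.Algebrization: as Relativi

History (route lifecycle, newest last):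
- 2026-09-04T12:43:00Z · DORMANT — reconciler: no traction for 5 d (last activity statement-checked at 2026-08-30T12:01:37Z); parked, not closed — `ledger route dormant route-PneNP-RootDecompDept (operator:999:2526083)

sub-problem: PneNP · status: dormant · opened planner-decomp-pnenp-writer-1-g4-0 2026-08-30T07:02:51Z · rev 0 · ledger route-PneNP-RootDecompDepthThree
GENERATED by the gate from the ledger (D-0016/17). Provers cite these decls: `theorem foo : Summit.PneNP.PneNP.Theses.RootDecompDepthThree.<Decl> := …` in Summits/PneNP/PneNP/Theorems/<Name>.lean.
-/

namespace Summit.PneNP.PneNP.Theses.RootDecompDepthThree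

open scoped BigOperators Topology Manifold Classical MeasureTheory ProbabilityTheory Matrix InnerProductSpace ComplexConjugate ContinuousMap
open Filter Set Function TopologicalSpace MeasureTheory

attribute [summit_statement] _root_.PneNP

open Literature.PNP

/-- item stmt-PneNP-29844 · crux · rank 2 · open · by planner
why it might fail: It cannot fail without deciding S (S → A₃); the risk is that its only road is Research Problem 11.2, whose known methods stop at 2^{O(√n)} (finite limits) and whose natural solutions are conditionally excluded by depth-3 weak-PRF candidates (Goldreich-PRG security).
sources: Jukna2012, Valiant1977, doi:10.1007/s00037-022-00220-x, HOME/decomp-pnenp-lens-4/DepthThreeLift.lean sha256 36023abc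
[crux] PIECE A₃ (attacked): if P = NP then some NP language is VALIANT-HARD — outside the depth-3
unbounded-fan-in class ΣΠΣ(2^{c·n/log₂log₂n + c}) for every c (lens decl `DepthThreeHard := ¬PneNP →
∃ L ∈ NP, ValiantHard L`, inlined over `DepthSizeClass acBasis 3`). Kernel P-form
`depthThreeHard_iff_P`: A₃ ⟺ (¬S → some P language is Valiant-hard); S-free road = Jukna Research
Problem 11.2 (record 2^{Ω(√n)}, open since 1977). [difficulty: open-problem] -/
@[route_item "route-PneNP-RootDecompDepthThree"]
def DepthThreeHard : Prop :=
  ¬ PneNP → ∃ L ∈ Literature.Computability.Complexity.Nondeterministic.NP, ∀ c : ℕ, L ∉ Literature.Computability.Complexity.DepthSizeClass Literature.Computability.Complexity.acBasis (fun _ : ℕ => 3) (fun n : ℕ => 2 ^ (c * n / Nat.log 2 (Nat.log 2 n) + c))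

/-- item stmt-PneNP-29845 · crux · rank 3 · open · by planner
why it might fail: False exactly in the world «P = NP and some P-language needs depth-3 size 2^{ω(n/log log n)}»; the second conjunct is widely expected TRUE (it is Research Problem 11.2 itself), so R₃ is expected to carry the whole summit (pre-costume).
sources: Jukna2012, Valiant1977, HOME/decomp-pnenp-lens-4/DepthThreeLift.lean sha256 36023abc
[crux] PIECE R₃ (DECLARED RESIDUAL, PRE-COSTUME declared): a Valiant-hard NP language separates P
from NP — contrapositively, P = NP ⟹ every NP (= P) language has depth-3 circuits of size 2^{O(n/log
log n)} (lens decl `DepthThreeLift`, inlined). Kernel: `depthThreeLift_iff_pneNP_of_PWitness` — R₃ ≡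
S as soon as ANY polynomial-time language is Valiant-hard (the expected outcome); relativized-false
(EXPSPACE oracle, pencil). [deps: DepthThreeHard] [difficulty: open-problem] -/
@[route_item "route-PneNP-RootDecompDepthThree"]
def DepthThreeLift : Prop :=
  (∃ L ∈ Literature.Computability.Complexity.Nondeterministic.NP, ∀ c : ℕ, L ∉ Literature.Computability.Complexity.DepthSizeClass Literature.Computability.Complexity.acBasis (fun _ : ℕ => 3) (fun n : ℕ => 2 ^ (c * n / Nat.log 2 (Nat.log 2 n) + c))) → PneNP

/-- item stmt-PneNP-29846 · aside · rank 9 · open · by planner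
sources: Jukna2012, Valiant1977
[aside] PRINT BINDER (ASIDE, formalisation target, NOT in the cone — law II): Valiant's depth
reduction NC¹_lin ⊆ ΣΠΣ(2^{O(n/log log n)}): for every c there is c' with the fan-in-2 class of
depth ≤ c·log₂n + c and size ≤ c·n + c inside ΣΠΣ(2^{c'·n/log₂log₂n + c'}) (Jukna2012 Lemma 11.1;
Erdős–Graham–Szemerédi edge removal + CNF bookkeeping). [difficulty: L] -/
@[route_item "route-PneNP-RootDecompDepthThree"]
def ValiantLift : Prop :=
  ∀ c : ℕ, ∃ c' : ℕ, Literature.Computability.Complexity.DepthSizeClass Literature.Computability.Complexity.B2 (fun n : ℕ => c * Nat.log 2 n + c) (fun n : ℕ => c * n + c) ⊆ Literature.Computability.Complexity.DepthSizeClass Literature.Computability.Complexity.acBasis (fun _ : ℕ => 3) (fun n : ℕ => 2 ^ (c' * n / Nat.log 2 (Nat.log 2 n) + c'))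

/-- item stmt-PneNP-29847 · aside · rank 9 · open · by planner
sources: GolovnevKulikovWilliams2018, Jukna2012
[aside] PRINT BINDER (ASIDE, NOT in the cone — law II(d)): Golovnev–Kulikov–Williams 2018 — every
size-s circuit over the full binary basis is an OR of 2^{⌈s/3.9⌉} ANDs of 2^{14}s ORs of 16
literals, typed loosely as SIZE(s) ⊆ ΣΠΣ(2^{s/3+1}·(2^{14}s+1) + n + 1); its image is a LINEAR
general size bound, Kannan-idle (`gkwImageResidual_iff_pneNP`, `gkw_ceiling`). [difficulty: L] -/
@[route_item "route-PneNP-RootDecompDepthThree"]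
def GKWLift : Prop :=
  ∀ s : ℕ → ℕ, Literature.Computability.Complexity.SIZE s ⊆ Literature.Computability.Complexity.DepthSizeClass Literature.Computability.Complexity.acBasis (fun _ : ℕ => 3) (fun n : ℕ => 2 ^ (s n / 3 + 1) * (2 ^ 14 * s n + 1) + n + 1)

/-- item stmt-PneNP-29848 · assembly · rank 1 · open · by planner
sources: HOME/decomp-pnenp-lens-4/DepthThreeLift.lean sha256 36023abc
[assembly] DepthThreeHard → DepthThreeLift → P ≠ NP. -/
@[route_item "route-PneNP-RootDecompDepthThree"]
def Assembly : Prop :=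
  DepthThreeHard → DepthThreeLift → PneNP

/-! D-0027 §2.1 — DECIDING THEOREM (planner-authored via `route open/edit --closes-file`; by planner-decomp-pnenp-writer-1-g4-0 2026-08-30T07:02:51Z):
its hypotheses are this route's items and its conclusion the sub-problem Statement (glue_lint), and it elaborates with this file. -/

@[closes "route-PneNP-RootDecompDepthThree"] theorem closes (hA : DepthThreeHard) (hR : DepthThreeLift) : _root_.PneNP :=
  Classical.byContradiction fun hS => hS (hR (hA hS))

end Summit.PneNP.PneNP.Theses.RootDecompDepthThree
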